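import Literature.MathematicalPhysics.QuantumFieldTheory.Balaban1983to89.T3RegularMinimiserReduction
import Literature.MathematicalPhysics.QuantumFieldTheory.Balaban1983to89.B10Eq68TorusRegularity
import HarnessLib

/-!
# `Balaban1983to89.T3PrintedRegularMinimiser` — rung R3, crux K1: the background | fluctuation split of `UnitTilt` AT THE MINIMUM OVER
# PRINT'S REGULAR SPACE `𝔘_k(ε₀)` IN FULL — BOTH clauses of [Balaban1985Variational] (2) = [Balaban1985RegularSpaces] (1.7) + (1.9):
# small plaquette variables AND small covariant divergence of the plaquette field — typed next to the tree's plaquette-only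
# `T3RegularMinimiser.regFibre`, with the dictionary to the LQB lane's full space `B10Eq68TorusRegularity.InSpace` and the located gap
# between the two named as a schema

Cell `ym3-torus` (HUMAN RULING D-0037, YM ladder rung R3), seat `ym3-torus-p1` gen 5; cell record HOME/UV3-NODE.md §12 (finding F-g5-1).
WHAT THIS IS NOT: no estimate — schemas (never asserted) and their kernel-checked composition; not d = 4, not a mass gap.

WHY.  `T3RegularMinimiser` (p411848) re-based K1's split on the minimum of the Wilson action over `regFibre = fibre ∩ {|U(∂p) − 1| <
ε₀L^{−2(K−n)}}`, the PLAQUETTE clause of [Balaban1985Variational] (2).  Print's regular space has a SECOND clause: [Balaban1985RegularSpaces]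
p. 77 defines `𝔘_k({Ω_j}, α₀)` by (1.7) «|U(∂p) − 1| < α₀L^{−2j} for p ∈ Ω_j» AND (1.9) «|(D^{η*}_U ∂U)(b)| < α₀L^{−2j}(L^jη)^{−1} for b ∈ Ω_j»,
the covariant divergence (1.1)–(1.2) p. 76 of the plaquette field (a lattice derivative, prefactor `η⁻¹`); [Balaban1985Variational] (2) p. 278
repeats both clauses, and its Theorem 1 p. 279 — «there exists a minimal orbit in the space 𝔘_k({Ω_j}, B₃ε₁) ∩ 𝔅_k(𝔅_k, V) (8). This orbit is
a unique critical orbit in the space (6) if B₃ε₁ ≤ ε₀ and ε₀ ≤ a₀» —, made precise on p. 281 l. 19–21 «there exists exactly one critical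
configuration, which is a minimum of the functional (5)» (in the space (19)–(21) ≅ (18) ≅ (6) modulo gauge), is EXISTENCE AND UNIQUENESS OF
THE MINIMUM OVER (6) = BOTH CLAUSES ∩ THE CONSTRAINT; the gauge fixing it rests on ([Balaban1985RegularSpaces] Thm 2, hypothesis (1.34)
`U′U₀ ∈ 𝔘_k`) and the background-field propagator bounds ((1.33) «(3.35) in [4]») are stated on the two-clause space only.  Hence the tree's
`T3RegularMinimiserReduction.HasRegMinimisersAt` (the minimum over the plaquette-only regular fibre is attained) is [7] Thm 1 PLUS the
unprinted statement «inf over fibre ∩ {plaquette clause} = min over fibre ∩ {both clauses}» (cell gap G-K1aR-1; `RegInfAgreeAt` of the sibling).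
This file types the printed object: §1 the divergence clause at the top scale `j = k = K − n` of the pure small-field problem (all `Ω_j` the
whole torus; η-free form `‖(D^{1*}_U∂U)(b)‖ < ε₀L^{−3(K−n)}`, [Balaban1985RegularSpaces] p. 77 «(1.7) may be replaced by (1.8)») with the
DICTIONARY `regPr_iff_inSpace` to the LQB lane's `B10Eq68TorusRegularity.InSpace (K−n) (fun _ ↦ univ) ε₀ η (toUField U)` = [7] (2) in full
with body on the torus; §2 `regFibrePr ⊆ regFibre` and `minActionRegPr ≥ minActionReg`; §3 the twins `MinimiserStabilityRegPrAt` /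
`FluctuationComparisonRegPrAt` (instances of p411848's functional-agnostic `BgStabilityAt` / `BgFluctuationAt`), their glue to `UnitTiltAt`,
idle constants, and the K1-shaped composition `unitTilt_shape_of_regPr`.  The sibling `T3PrintedRegularMinimiserReduction` carries the
layer-3 schemas (`HasRegMinimisersPrAt` = [7] Thm 1 read in the family's vocabulary; PORT caveat: print's averaging is [Balaban1985Averaging]'s,
the family's is (0.4) of [Balaban1987RG1]), the reduction, and the bridge to the plaquette-only twins through the schema `RegInfAgreeAt` (§5 there).

References: T. Bałaban, CMP 102 (1985) 277–309 [Balaban1985Variational] ((2) p.278, Thm 1 (8) p.279, p.281 l.19–21); CMP 99 (1985) 75–102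
[Balaban1985RegularSpaces] ((1.1)–(1.2) p.76, (1.7)–(1.9) p.77, (1.33)–(1.34) p.82); CMP 102 (1985) 255–275 [Balaban1985UV3] ((41) p.266);
C. King, CMP 102 (1986) 649–677 [King1986] (Thm 3.4 (3.9), App. (A.5)); P. Federbush, CMP 110 (1987) 293 [Federbush1987PhaseCellIII].
-/

noncomputable section

open MeasureTheory Filter Topology
open scoped Matrix.Norms.L2Operator
open Literature.MathematicalPhysics.QuantumFieldTheory.Balaban1983to89.T3ContinuumYM3Torus
open Literature.MathematicalPhysics.QuantumFieldTheory.Balaban1983to89.T3UnitLawDensityEML (ℰp measurableE_ℰp)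
open Literature.MathematicalPhysics.QuantumFieldTheory.Balaban1983to89.T3UnitScaleTilt
open Literature.MathematicalPhysics.QuantumFieldTheory.Balaban1983to89.T3TiltDescent
open Literature.MathematicalPhysics.QuantumFieldTheory.Balaban1983to89.T3CruxEstimates
open Literature.MathematicalPhysics.QuantumFieldTheory.Balaban1983to89.T3ConstrainedMinimiser
open Literature.MathematicalPhysics.QuantumFieldTheory.Balaban1983to89.T3DescentFibreTower
open Literature.MathematicalPhysics.QuantumFieldTheory.Balaban1983to89.T3MinimiserStabilityReduction
open Literature.MathematicalPhysics.QuantumFieldTheory.Balaban1983to89.T3RegularMinimiser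
open Literature.MathematicalPhysics.QuantumFieldTheory.Balaban1983to89.T3RegularMinimiserReduction
open Literature.MathematicalPhysics.QuantumFieldTheory.Balaban1983to89.B10Eq27TorusAxialLog (toUField unitsField val_unitsField
  dist1_plaqHol_toUField)
open Literature.MathematicalPhysics.QuantumFieldTheory.Balaban1983to89.B10Eq68TorusRegularity (covDivT covDivT_one InSpace InSpace2
  RegAt RegDivAt Touches BTouches inSpace_iff regDivAt_iff_unit)
open Literature.MathematicalPhysics.QuantumFieldTheory.Balaban1983to89.Missing

namespace Literature.MathematicalPhysics.QuantumFieldTheory.Balaban1983to89.T3PrintedRegularMinimiser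

/-! ## §1 The covariant-divergence clause of print's regular space at the top scale, and the dictionary to the LQB full space -/

section Clause

variable (F : T3Family) (n K : ℕ) (ε₀ : ℝ)

/-- **THE SECOND CLAUSE OF [7] (2) = [6] (1.9) AT THE TOP SCALE** of run `K` relative to the comparison height `n` (pure small-field problem:
every `Ω_j` the whole torus, so the binding clause is `j = k = K − n`), in its `η`-free form: `‖(D^{1*}_U ∂U)(b)‖ < ε₀·L^{−3(K−n)}` for every
bond `b` of the finest lattice of the `K`-th approximation (`D^{η*} = η⁻¹D^{1*}`, `η = L^{−(K−n)}`; the `SU(2)` field read in `M₂(ℂ)` through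
`SU(2) ≤ U(2)`, operator norm; = the second clause of [Balaban1985Variational] (2) p. 278). [cite: Balaban1985RegularSpaces, (1.9) p.77] -/
def DivSmall (U : GaugeField (F.P K) 0 (Matrix.specialUnitaryGroup (Fin 2) ℂ)) : Prop :=
  ∀ b : PBond (F.P K) 0, ‖covDivT 1 (unitsField (toUField U)) b.dir b.src‖ < ε₀ * ((F.L : ℝ)⁻¹) ^ (3 * (K - n))

/-- **`U ∈ 𝔘_k(ε₀)` IN FULL** for the pure small-field problem of run `K` over the comparison height `n`: the plaquette clause
`|U(∂p) − 1| < ε₀L^{−2(K−n)}` (the tree's `regThreshold`) AND the divergence clause ([Balaban1985RegularSpaces] (1.7) + (1.9) p. 77). [cite: Balaban1985Variational, (2) p.278] -/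
def RegPr (U : GaugeField (F.P K) 0 (Matrix.specialUnitaryGroup (Fin 2) ℂ)) : Prop :=
  PlaqSmall (regThreshold F n K ε₀) U ∧ DivSmall F n K ε₀ U

variable {F n K ε₀}

/-- The plaquette half of a printed-regular configuration. [cite: Balaban1985Variational, (2) p.278] -/
theorem RegPr.plaqSmall {U : GaugeField (F.P K) 0 (Matrix.specialUnitaryGroup (Fin 2) ℂ)} (h : RegPr F n K ε₀ U) :
    PlaqSmall (regThreshold F n K ε₀) U :=
  h.1

/-- The divergence half of a printed-regular configuration. [cite: Balaban1985RegularSpaces, (1.9) p.77] -/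
theorem RegPr.divSmall {U : GaugeField (F.P K) 0 (Matrix.specialUnitaryGroup (Fin 2) ℂ)} (h : RegPr F n K ε₀ U) :
    DivSmall F n K ε₀ U :=
  h.2

/-- The trivial `SU(2)` configuration read in the units of `M₂(ℂ)` is the trivial units configuration. [cite: Balaban1985Averaging, (19) p.21] -/
theorem unitsField_toUField_one :
    unitsField (toUField (1 : GaugeField (F.P K) 0 (Matrix.specialUnitaryGroup (Fin 2) ℂ))) = fun _ => 1 := by
  funext b
  apply Units.ext
  rw [val_unitsField, Units.val_one]
  rfl

/-- **NON-VACUITY**: `U ≡ 1` satisfies the divergence clause for every `ε₀ > 0` (`D*∂1 = 0`, `covDivT_one`). [cite: Balaban1985RegularSpaces, (1.9) p.77] -/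
theorem divSmall_one (hε : 0 < ε₀) : DivSmall F n K ε₀ (1 : GaugeField (F.P K) 0 (Matrix.specialUnitaryGroup (Fin 2) ℂ)) := by
  intro b
  rw [unitsField_toUField_one, covDivT_one, norm_zero]
  have hL : (0 : ℝ) < (F.L : ℝ)⁻¹ := inv_pos.mpr (by have := F.hL.2; exact_mod_cast (by omega : 0 < F.L))
  positivity

/-- **NON-VACUITY**: `U ≡ 1 ∈ 𝔘_k(ε₀)` in full, `ε₀ > 0`. [cite: Balaban1985Variational, (2) p.278] -/
theorem regPr_one (hε : 0 < ε₀) : RegPr F n K ε₀ (1 : GaugeField (F.P K) 0 (Matrix.specialUnitaryGroup (Fin 2) ℂ)) :=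
  ⟨plaqSmall_one (regThreshold_pos F hε), divSmall_one hε⟩

/-- The block size of every approximation is the family's `L` (bookkeeping). [cite: Balaban1985UV3, (1)-(3) p.256] -/
private theorem P_L_cast (K : ℕ) : ((F.P K).L : ℝ) = F.L := rfl

/-- `((L^k)⁻¹)^a = (L⁻¹)^{a·k}` (bookkeeping between the LQB letters and the tree's `regThreshold`). [cite: Balaban1985Variational, (2) p.278] -/
private theorem inv_pow_pow (x : ℝ) (k a : ℕ) : ((x ^ k)⁻¹) ^ a = (x⁻¹) ^ (a * k) := by
  rw [← inv_pow, ← pow_mul, mul_comm]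

/-- Every plaquette / bond of the torus touches the whole torus (the pure small-field case «Ω_j = T_η», [6] p. 77). [cite: Balaban1985RegularSpaces, p.77 (sentence after (1.6))] -/
private theorem touches_univ (q : Plaq (F.P K) 0) : Touches (Set.univ : Set (Site (F.P K) 0)) q := Or.inl (Set.mem_univ _)

/-- The same for bonds. [cite: Balaban1985RegularSpaces, p.77 (sentence after (1.6))] -/
private theorem btouches_univ (b : PBond (F.P K) 0) : BTouches (Set.univ : Set (Site (F.P K) 0)) b := Or.inl (Set.mem_univ _)

/-- **DICTIONARY — `RegPr` IS [7] (2) IN FULL ON THE TORUS** (the LQB lane's `B10Eq68TorusRegularity.InSpace`, both clauses for all scales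
`j ≤ k`, with every `Ω_j` the whole torus, `k = K − n`, `η = L^{−(K−n)}`, read through `SU(2) ≤ U(2)`): for `ε₀ ≥ 0` the top-scale clauses imply
all lower ones ([6] p. 77 «if these conditions hold for some j = l, then they hold for all j < l») and the `η`-form of (1.9) is its `η = 1` form
(`regDivAt_iff_unit`; [Balaban1985RegularSpaces] (1.7)–(1.9) p. 77). [cite: Balaban1985Variational, (2) p.278] -/
theorem regPr_iff_inSpace (hε : 0 ≤ ε₀) (U : GaugeField (F.P K) 0 (Matrix.specialUnitaryGroup (Fin 2) ℂ)) :
    RegPr F n K ε₀ U ↔ InSpace (K - n) (fun _ => (Set.univ : Set (Site (F.P K) 0))) ε₀ (((F.L : ℝ)⁻¹) ^ (K - n)) (toUField U) := by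
  have hL0 : (0 : ℝ) < (F.L : ℝ)⁻¹ := inv_pos.mpr (by have := F.hL.2; exact_mod_cast (by omega : 0 < F.L))
  have hη : (0 : ℝ) < ((F.L : ℝ)⁻¹) ^ (K - n) := pow_pos hL0 _
  rw [inSpace_iff]
  constructor
  · rintro ⟨hpl, hdiv⟩
    refine ⟨fun j hj => ?_, fun j hj => ?_⟩
    · -- the plaquette clause at the top scale `k = K − n`, then at every `j ≤ k`
      have htop : RegAt (K - n) (Set.univ : Set (Site (F.P K) 0)) ε₀ (toUField U) := by
        intro q _
        rw [dist1_plaqHol_toUField, P_L_cast, inv_pow_pow]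
        exact hpl q
      exact htop.of_le_level hj hε
    · have htop : RegDivAt (K - n) (Set.univ : Set (Site (F.P K) 0)) ε₀ (((F.L : ℝ)⁻¹) ^ (K - n))
          (unitsField (toUField U)) := by
        rw [regDivAt_iff_unit hη]
        intro b _
        rw [P_L_cast, inv_pow_pow]
        exact hdiv b
      exact htop.of_le_level hj hε hη
  · rintro ⟨hpl, hdiv⟩
    refine ⟨fun q => ?_, fun b => ?_⟩
    · have h := (hpl (K - n) le_rfl) q (touches_univ q)
      rwa [dist1_plaqHol_toUField, P_L_cast, inv_pow_pow] at h
    · have h := ((regDivAt_iff_unit hη _).mp (hdiv (K - n) le_rfl)) b (btouches_univ b)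
      rwa [P_L_cast, inv_pow_pow] at h

end Clause

/-! ## §2 Print's regular fibre (6) and the minimum over it, next to the tree's plaquette-only `regFibre` -/

section Regular

variable (F : T3Family) (n K : ℕ) (h : n ≤ K) (ε₀ : ℝ)

/-- **PRINT'S SPACE (6) `𝔘_k(ε₀) ∩ 𝔅_k(V)` FOR THE FAMILY**: the descent fibre of `V` (the averaging constraint (3), here for the (0.4)
averaging `ℰp` of the family) intersected with BOTH clauses of (2) — the tree's plaquette-only `regFibre` cut down by the divergence clause.
[cite: Balaban1985Variational, (6) p.278] -/
def regFibrePr (V : GaugeField (F.P n) 0 (Matrix.specialUnitaryGroup (Fin 2) ℂ)) :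
    Set (GaugeField (F.P K) 0 (Matrix.specialUnitaryGroup (Fin 2) ℂ)) :=
  regFibre F ℰp n K h ε₀ V ∩ {U | DivSmall F n K ε₀ U}

/-- **THE MINIMUM OF THE WILSON ACTION OVER PRINT'S SPACE (6)** — the action of Bałaban's background field `U_k(V)` when [7] Thm 1 applies
(`sInf ∅ = 0` off its hypotheses). [cite: Balaban1985Variational, Thm 1 (8) p.279] -/
def minActionRegPr (V : GaugeField (F.P n) 0 (Matrix.specialUnitaryGroup (Fin 2) ℂ)) : ℝ :=
  sInf ((fun U => wilsonAction4 U) '' regFibrePr F n K h ε₀ V)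

variable {n K h ε₀}

/-- Membership in print's regular fibre = membership in the descent fibre ∧ both clauses of (2). [cite: Balaban1985Variational, (6) p.278] -/
theorem mem_regFibrePr_iff {V : GaugeField (F.P n) 0 (Matrix.specialUnitaryGroup (Fin 2) ℂ)}
    {U : GaugeField (F.P K) 0 (Matrix.specialUnitaryGroup (Fin 2) ℂ)} :
    U ∈ regFibrePr F n K h ε₀ V ↔ U ∈ fibre F ℰp n K h V ∧ RegPr F n K ε₀ U :=
  ⟨fun hU => ⟨hU.1.1, hU.1.2, hU.2⟩, fun hU => ⟨⟨hU.1, hU.2.1⟩, hU.2.2⟩⟩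

/-- Print's regular fibre lies inside the tree's plaquette-only one. [cite: Balaban1985Variational, (2) p.278, (6) p.278] -/
theorem regFibrePr_subset_regFibre (V : GaugeField (F.P n) 0 (Matrix.specialUnitaryGroup (Fin 2) ℂ)) :
    regFibrePr F n K h ε₀ V ⊆ regFibre F ℰp n K h ε₀ V :=
  Set.inter_subset_left

/-- `0 ≤ minActionRegPr V`. [cite: Balaban1985Variational, Thm 1 (8) p.279] -/
theorem minActionRegPr_nonneg (V : GaugeField (F.P n) 0 (Matrix.specialUnitaryGroup (Fin 2) ℂ)) : 0 ≤ minActionRegPr F n K h ε₀ V := by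
  unfold minActionRegPr
  by_cases hne : ((fun U => wilsonAction4 U) '' regFibrePr F n K h ε₀ V).Nonempty
  · exact le_csInf hne (by rintro _ ⟨U, _, rfl⟩; exact wilsonAction4_nonneg U)
  · rw [Set.not_nonempty_iff_eq_empty.mp hne, Real.sInf_empty]

/-- `minActionRegPr V ≤ A(U)` for every printed-regular `U` in the fibre of `V`. [cite: Balaban1985Variational, Thm 1 (8) p.279] -/
theorem minActionRegPr_le {V : GaugeField (F.P n) 0 (Matrix.specialUnitaryGroup (Fin 2) ℂ)}
    {U : GaugeField (F.P K) 0 (Matrix.specialUnitaryGroup (Fin 2) ℂ)} (hU : U ∈ regFibrePr F n K h ε₀ V) :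
    minActionRegPr F n K h ε₀ V ≤ wilsonAction4 U :=
  csInf_le ⟨0, by rintro _ ⟨U', _, rfl⟩; exact wilsonAction4_nonneg U'⟩ ⟨U, hU, rfl⟩

/-- The plaquette-only regular minimum is below print's when print's fibre is nonempty (bigger set, smaller infimum).
[cite: Balaban1985Variational, Thm 1 (8) p.279] -/
theorem minActionReg_le_minActionRegPr {V : GaugeField (F.P n) 0 (Matrix.specialUnitaryGroup (Fin 2) ℂ)}
    (hne : (regFibrePr F n K h ε₀ V).Nonempty) : minActionReg F ℰp n K h ε₀ V ≤ minActionRegPr F n K h ε₀ V :=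
  le_csInf (hne.image _) (by rintro _ ⟨U, hU, rfl⟩; exact minActionReg_le F ℰp (regFibrePr_subset_regFibre F V hU))

/-- The global fibre infimum is below print's regular minimum when print's fibre is nonempty. [cite: Balaban1985Variational, Thm 1 (8) p.279] -/
theorem minAction_le_minActionRegPr {V : GaugeField (F.P n) 0 (Matrix.specialUnitaryGroup (Fin 2) ℂ)}
    (hne : (regFibrePr F n K h ε₀ V).Nonempty) : minAction F ℰp n K h V ≤ minActionRegPr F n K h ε₀ V :=
  le_csInf (hne.image _) (by rintro _ ⟨U, hU, rfl⟩; exact minAction_le F ℰp hU.1.1)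

/-- A-priori bound: `minActionRegPr V ≤ 2·#plaquettes`. [cite: Balaban1985Variational, Thm 1 (8) p.279] -/
theorem minActionRegPr_le_two_mul_card (V : GaugeField (F.P n) 0 (Matrix.specialUnitaryGroup (Fin 2) ℂ)) :
    minActionRegPr F n K h ε₀ V ≤ 2 * Fintype.card (Plaq (F.P K) 0) := by
  by_cases hV : (regFibrePr F n K h ε₀ V).Nonempty
  · obtain ⟨U, hU⟩ := hV
    exact (minActionRegPr_le F hU).trans (wilsonAction4_le_two_mul_card U)
  · have : (fun U => wilsonAction4 U) '' regFibrePr F n K h ε₀ V = ∅ := by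
      rw [Set.image_eq_empty]; exact Set.not_nonempty_iff_eq_empty.mp hV
    unfold minActionRegPr
    rw [this, Real.sInf_empty]
    positivity

/-- The trivial configuration lies in print's regular fibre of itself (`ε₀ > 0`, `ℰp(1,…,1) = 1`). [cite: Balaban1985Variational, (6) p.278] -/
theorem one_mem_regFibrePr_one (hε : 0 < ε₀) :
    (1 : GaugeField (F.P K) 0 (Matrix.specialUnitaryGroup (Fin 2) ℂ)) ∈ regFibrePr F n K h ε₀ 1 :=
  ⟨one_mem_regFibre_one F ℰp expMeanLogSU_E_one hε, divSmall_one hε⟩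

/-- Hence `minActionRegPr (1) = 0`. [cite: Balaban1985Variational, Thm 1 (8) p.279] -/
theorem minActionRegPr_one (hε : 0 < ε₀) :
    minActionRegPr F n K h ε₀ (1 : GaugeField (F.P n) 0 (Matrix.specialUnitaryGroup (Fin 2) ℂ)) = 0 := by
  have h0 : wilsonAction4 (1 : GaugeField (F.P K) 0 (Matrix.specialUnitaryGroup (Fin 2) ℂ)) = 0 := by
    rw [← minAction_self F ℰp K 1]; exact minAction_one F ℰp expMeanLogSU_E_one le_rfl
  exact le_antisymm ((minActionRegPr_le F (one_mem_regFibrePr_one F hε)).trans_eq h0) (minActionRegPr_nonneg F _)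

end Regular

/-! ## §3 The twins at print's regular background, their glue, idle constants, and the K1-shaped composition -/

section Twins

variable (F : T3Family) (γ b₀ p₀ : ℝ) (m : ℕ) (ε₀ : ℝ)

/-- Print's regular background of run `K` at comparison height `⌊K/m⌋`: `β_K · minActionRegPr`. [cite: Balaban1985UV3, (41) p.266] -/
def bgRegPr (K : ℕ) (V : GaugeField (F.P (K / m)) 0 (Matrix.specialUnitaryGroup (Fin 2) ℂ)) : ℝ :=
  (F.scheme ℰp γ).β K * minActionRegPr F (K / m) K (Nat.div_le_self K m) ε₀ V

/-- Print's regular background of run `K+1` at the same comparison height. [cite: Balaban1985UV3, (41) p.266] -/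
def bgRegPr' (K : ℕ) (V : GaugeField (F.P (K / m)) 0 (Matrix.specialUnitaryGroup (Fin 2) ℂ)) : ℝ :=
  (F.scheme ℰp γ).β (K + 1) * minActionRegPr F (K / m) (K + 1) ((Nat.div_le_self K m).trans (Nat.le_succ K)) ε₀ V

/-- **MINIMISER STABILITY AT PRINT'S REGULAR BACKGROUND** (hypothesis schema, never asserted): `|β_{K+1}·minActionRegPr_{n,K+1}(V) −
β_K·minActionRegPr_{n,K}(V) − κ_K| ≤ r_K`, `Σ r < ∞`, for all small `V` — the two-cut-off consistency of the actions of Bałaban's background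
fields `U_k(V)` = the minima of [Balaban1985Variational] Thm 1 over the space (6) in full. [cite: Balaban1985Variational, Thm 1 (8)-(10) p.279] -/
def MinimiserStabilityRegPrAt : Prop := BgStabilityAt F γ b₀ p₀ m (bgRegPr F γ m ε₀) (bgRegPr' F γ m ε₀)

/-- **FLUCTUATION COMPARISON AT PRINT'S REGULAR BACKGROUND** (hypothesis schema, never asserted): with `U_k` print's minimiser,
`log ρ^{(K)} + β_K A(U_K) = Σ_j 𝒫_j + R` IS [Balaban1985UV3] (41)'s fluctuation part ((41) expands around exactly this `U_k`), so this is the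
two-run comparison of (41)'s expansion terms. [cite: Balaban1985UV3, (41) p.266] -/
def FluctuationComparisonRegPrAt : Prop := BgFluctuationAt F γ b₀ p₀ m (bgRegPr F γ m ε₀) (bgRegPr' F γ m ε₀)

variable {F γ b₀ p₀ m ε₀}

/-- **GLUE**: the printed-regular twins ⇒ `HeightSandwichAt F γ b₀ p₀ m` ∧ `UnitTiltAt F γ b₀ p₀ m` (`γ ≥ 0`; the functional-agnostic split of
`T3RegularMinimiser` §1). [cite: King1986, Thm 3.4 (3.9)-(3.13) p.656] -/
theorem heightSandwich_unitTilt_of_regPr (hγ : 0 ≤ γ) (hst : MinimiserStabilityRegPrAt F γ b₀ p₀ m ε₀)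
    (hfl : FluctuationComparisonRegPrAt F γ b₀ p₀ m ε₀) : HeightSandwichAt F γ b₀ p₀ m ∧ UnitTiltAt F γ b₀ p₀ m :=
  ⟨heightSandwichAt_of_bg hγ hst hfl, unitTiltAt_of_bg hγ hst hfl⟩

/-- **THE CONSTANTS ARE IDLE at print's regular background**: `|κ_K| ≤ r_K` (`V = 1` is small and printed-regular, both minima vanish;
`0 < γ ≤ 1`, `b₀ > 0`, `ε₀ > 0`). [cite: Balaban1985Variational, Thm 1 (8) p.279] -/
theorem abs_const_le_of_minimiserStabilityRegPr (hγ : 0 < γ) (hγ1 : γ ≤ 1) (hb : 0 < b₀) (hε : 0 < ε₀) {r κ : ℕ → ℝ}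
    (hr : ∀ K (V : GaugeField (F.P (K / m)) 0 (Matrix.specialUnitaryGroup (Fin 2) ℂ)), PlaqSmall (θBal F.L γ b₀ p₀ (K / m)) V →
      |bgRegPr' F γ m ε₀ K V - bgRegPr F γ m ε₀ K V - κ K| ≤ r K) (K : ℕ) : |κ K| ≤ r K := by
  have h1 := hr K 1 (plaqSmall_one (θBal_pos F.hL.2.le hγ hγ1 hb p₀ (K / m)))
  simp only [bgRegPr, bgRegPr', minActionRegPr_one F hε, mul_zero, sub_zero, zero_sub, abs_neg] at h1
  exact h1

/-- **THE K1-SHAPED COMPOSITION with `ε₀` quantified «for all sufficiently small» in BOTH children** (the form a glued split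
`UnitTilt ⇐ MinimiserStabilityRegPr ∧ FluctuationComparisonRegPr` takes; common `ε₀ := min ε₁ ε₁'`, `m := max (max m₀ m₀') 1`,
`γ₁ := min γ₁ γ₁'`): conclusion = the body of the route's `UnitTilt` for one `L`. [cite: King1986, Thm 3.4 (3.9)-(3.13) p.656] -/
theorem unitTilt_shape_of_regPr (L : ℕ)
    (h₁ : ∃ ε₁ : ℝ, 0 < ε₁ ∧ ∀ ε₀ : ℝ, 0 < ε₀ → ε₀ ≤ ε₁ → ∃ m₀ : ℕ, ∀ m : ℕ, m₀ ≤ m → ∀ b₀ p₀ : ℝ, 0 < b₀ → 2 < p₀ →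
      ∃ γ₁ : ℝ, 0 < γ₁ ∧ ∀ (F : T3Family) (γ : ℝ), F.L = L → 0 < γ → γ ≤ γ₁ → MinimiserStabilityRegPrAt F γ b₀ p₀ m ε₀)
    (h₂ : ∃ ε₁ : ℝ, 0 < ε₁ ∧ ∀ ε₀ : ℝ, 0 < ε₀ → ε₀ ≤ ε₁ → ∃ m₀ : ℕ, ∀ m : ℕ, m₀ ≤ m → ∀ b₀ p₀ : ℝ, 0 < b₀ → 2 < p₀ →
      ∃ γ₁ : ℝ, 0 < γ₁ ∧ ∀ (F : T3Family) (γ : ℝ), F.L = L → 0 < γ → γ ≤ γ₁ → FluctuationComparisonRegPrAt F γ b₀ p₀ m ε₀) :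
    ∃ m : ℕ, 0 < m ∧ ∀ b₀ p₀ : ℝ, 0 < b₀ → 2 < p₀ → ∃ γ₁ : ℝ, 0 < γ₁ ∧
      ∀ (F : T3Family) (γ : ℝ), F.L = L → 0 < γ → γ ≤ γ₁ → UnitTiltAt F γ b₀ p₀ m := by
  obtain ⟨ε₁, hε₁, h₁⟩ := h₁
  obtain ⟨ε₁', hε₁', h₂⟩ := h₂
  obtain ⟨m₁, hm₁⟩ := h₁ (min ε₁ ε₁') (lt_min hε₁ hε₁') (min_le_left _ _)
  obtain ⟨m₂, hm₂⟩ := h₂ (min ε₁ ε₁') (lt_min hε₁ hε₁') (min_le_right _ _)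
  refine ⟨max (max m₁ m₂) 1, lt_of_lt_of_le Nat.one_pos (le_max_right _ _), fun b₀ p₀ hb hp => ?_⟩
  obtain ⟨γ₁, hγ₁, hA⟩ := hm₁ _ ((le_max_left _ _).trans (le_max_left _ _)) b₀ p₀ hb hp
  obtain ⟨γ₂, hγ₂, hB⟩ := hm₂ _ ((le_max_right _ _).trans (le_max_left _ _)) b₀ p₀ hb hp
  refine ⟨min γ₁ γ₂, lt_min hγ₁ hγ₂, fun F γ hL hγ hle => ?_⟩
  exact (heightSandwich_unitTilt_of_regPr hγ.le (hA F γ hL hγ (hle.trans (min_le_left _ _)))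
    (hB F γ hL hγ (hle.trans (min_le_right _ _)))).2

end Twins

end Literature.MathematicalPhysics.QuantumFieldTheory.Balaban1983to89.T3PrintedRegularMinimiser

end
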